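import Mathlib
import HarnessLib

/-!
# The Kibble–Zurek freeze-out estimates (del Campo–Zurek 2014, §2)

HONEST FRAMING: instance-level adjudication of specific advantage claims; no claim about
BQP vs BPP or the summit.

The "Kibble–Zurek scaling" that the register's annealing-quench rows quote (kink density
`∝ t_a^{-1/2}` for the transverse-field Ising chain, `∝ τ_Q^{-dν/(1+zν)}` in general) is the
following algebra, printed in [cite: DelCampoZurek2014KZM, §2] (A. del Campo, W. H. Zurek,
*Universality of phase transition dynamics: Topological defects from symmetry breaking*,
Int. J. Mod. Phys. A 29, 1430018 (2014) = arXiv:1310.1600; held text `paper:arxiv-1310.1600`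
p0004–p0005, p0007), verbatim:

> "the equilibrium correlation length `ξ(ε) = ξ_0/|ε|^ν`, and equilibrium relaxation time
> `τ(ε) = τ_0/|ε|^{zν}` … we assume a linear quench … `ε(t) = t/τ_Q` … The boundary between the
> adiabatic and frozen stages can be estimated by comparing the equilibrium relaxation time with
> the time elapsed after crossing the critical point `τ(t) ≈ |ε/ε̇| = t`. This equation [Zurek85]
> yields the time scale `t̂ ∼ (τ_0 τ_Q^{zν})^{1/(1+zν)}`, known as the freeze-out time. … within
> the interval `ε ∈ [−ε̂, ε̂]`, where `ε̂ ≡ |ε(t̂)| ∼ (τ_0/τ_Q)^{1/(1+zν)}`. … The KZM sets the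
> average size of these domains by the value of the equilibrium correlation length at `ε̂`
> [Zurek85], `ξ̂ ≡ ξ[ε̂] = ξ_0 (τ_Q/τ_0)^{ν/(1+zν)}`. This is the main prediction of the KZM. …
> The above estimate of the `ξ̂` is often recast as an estimate for the resulting density of
> topological defects, `n ∼ ξ̂^d/ξ̂^D = (1/ξ_0^{D−d}) (τ_0/τ_Q)^{(D−d)ν/(1+zν)}`, where `D` and `d`
> are the dimensions of the space and of the defects"

and §3.2 (p0007): "The resulting amount of excitations is found to scale as `n ∝ τ_Q^{−1/2}`.
This result is based on an exact solution of the dynamics for the Ising model … it can be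
extended to an arbitrary `D` dimensional Hamiltonian … with a quantum critical point
characterized by critical exponents `ν` and `z`, leading to the estimate
`n ∝ τ_Q^{−(D−d)ν/(νz+1)}`".

This file records the definitions and PROVES the `∼`-free content of these displays as exact
identities between the defined quantities (the paper's `∼` drops `O(1)` prefactors, which are
set to `1` here, as in the displayed formulas themselves): the freeze-out time solves the
freeze-out equation `τ(ε(t̂)) = t̂` (`relaxTime_freezeOut`), `ε̂ = t̂/τ_Q = (τ_0/τ_Q)^{1/(1+zν)}`
(`reducedParam_freezeOutTime`), `ξ[ε̂] = ξ_0 (τ_Q/τ_0)^{ν/(1+zν)}` (`corrLength_freezeOutEps`),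
`ξ̂^d/ξ̂^D = ξ_0^{−(D−d)} (τ_0/τ_Q)^{(D−d)ν/(1+zν)}` (`defect_density_eq`), the transverse-Ising
exponent `(1−0)·1/(1+1·1) = 1/2` (`kzExponent_ising_chain`), and — a consequence proved here —
that the defect estimate is antitone in the quench time `τ_Q` (`defectEstimate_antitone`).
Nothing about any Hamiltonian, any dynamics, or the validity of the adiabatic–impulse
approximation is formalized.  No named facts, no `sorry`.
-/

namespace Literature.MathematicalPhysics.StatisticalMechanics

open Real

namespace KibbleZurek

/-! ## §1 The printed quantities -/

/-- Equilibrium correlation length `ξ(ε) = ξ_0/|ε|^ν`. [cite: DelCampoZurek2014KZM, §2 eq. (xieq)] -/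
noncomputable def corrLength (ξ₀ ν ε : ℝ) : ℝ := ξ₀ / |ε| ^ ν

/-- Equilibrium relaxation time `τ(ε) = τ_0/|ε|^{zν}`. [cite: DelCampoZurek2014KZM, §2 eq. (taueq)] -/
noncomputable def relaxTime (τ₀ z ν ε : ℝ) : ℝ := τ₀ / |ε| ^ (z * ν)

/-- The linear quench `ε(t) = t/τ_Q`. [cite: DelCampoZurek2014KZM, §2 eq. (varepst)] -/
noncomputable def reducedParam (τQ t : ℝ) : ℝ := t / τQ

/-- The freeze-out time `t̂ = (τ_0 τ_Q^{zν})^{1/(1+zν)}`. [cite: DelCampoZurek2014KZM, §2 (display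
after "This equation [Zurek85] yields the time scale")] -/
noncomputable def freezeOutTime (τ₀ τQ z ν : ℝ) : ℝ := (τ₀ * τQ ^ (z * ν)) ^ (1 / (1 + z * ν))

/-- `ε̂ = (τ_0/τ_Q)^{1/(1+zν)}`. [cite: DelCampoZurek2014KZM, §2 (display defining ε̂)] -/
noncomputable def freezeOutEps (τ₀ τQ z ν : ℝ) : ℝ := (τ₀ / τQ) ^ (1 / (1 + z * ν))

/-- `ξ̂ = ξ_0 (τ_Q/τ_0)^{ν/(1+zν)}` — "the main prediction of the KZM".
[cite: DelCampoZurek2014KZM, §2 (display defining ξ̂)] -/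
noncomputable def freezeOutLength (ξ₀ τ₀ τQ z ν : ℝ) : ℝ := ξ₀ * (τQ / τ₀) ^ (ν / (1 + z * ν))

/-- The Kibble–Zurek exponent `(D − d)ν/(1 + zν)` of the defect density in the quench time.
[cite: DelCampoZurek2014KZM, §2 (display for n) and §3.2 ("n ∝ τ_Q^{−(D−d)ν/(νz+1)}")] -/
noncomputable def kzExponent (D d : ℕ) (ν z : ℝ) : ℝ := ((D : ℝ) - d) * ν / (1 + z * ν)

/-- The defect-density estimate `n ∼ ξ_0^{−(D−d)} (τ_0/τ_Q)^{(D−d)ν/(1+zν)}`.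
[cite: DelCampoZurek2014KZM, §2 (display for n)] -/
noncomputable def defectEstimate (ξ₀ τ₀ τQ z ν : ℝ) (D d : ℕ) : ℝ :=
  (ξ₀ ^ (D - d))⁻¹ * (τ₀ / τQ) ^ kzExponent D d ν z

/-! ## §2 The freeze-out time solves the freeze-out equation -/

section

variable {τ₀ τQ z ν : ℝ}

/-- `t̂ > 0`. [folklore] -/
private theorem freezeOutTime_pos (hτ₀ : 0 < τ₀) (hτQ : 0 < τQ) : 0 < freezeOutTime τ₀ τQ z ν :=
  rpow_pos_of_pos (mul_pos hτ₀ (rpow_pos_of_pos hτQ _)) _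

/-- `t̂^{1+zν} = τ_0 τ_Q^{zν}`. [folklore] -/
private theorem freezeOutTime_rpow (hτ₀ : 0 < τ₀) (hτQ : 0 < τQ) (hzν : 0 ≤ z * ν) :
    freezeOutTime τ₀ τQ z ν ^ (1 + z * ν) = τ₀ * τQ ^ (z * ν) := by
  unfold freezeOutTime
  have hb : 0 ≤ τ₀ * τQ ^ (z * ν) := (mul_pos hτ₀ (rpow_pos_of_pos hτQ _)).le
  have hp : (1 + z * ν) ≠ 0 := by positivity
  rw [← rpow_mul hb, one_div, inv_mul_cancel₀ hp, rpow_one]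

/-- **The freeze-out time solves `τ(ε(t̂)) = t̂`**: with `τ(ε) = τ_0/|ε|^{zν}` and `ε(t) = t/τ_Q`,
`t̂ = (τ_0 τ_Q^{zν})^{1/(1+zν)}` satisfies the freeze-out equation exactly.
[cite: DelCampoZurek2014KZM, §2 ("τ(t) ≈ |ε/ε̇| = t … yields the time scale t̂")] -/
theorem relaxTime_freezeOut (hτ₀ : 0 < τ₀) (hτQ : 0 < τQ) (hzν : 0 ≤ z * ν) :
    relaxTime τ₀ z ν (reducedParam τQ (freezeOutTime τ₀ τQ z ν)) = freezeOutTime τ₀ τQ z ν := by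
  set t := freezeOutTime τ₀ τQ z ν with ht
  have htpos : 0 < t := freezeOutTime_pos hτ₀ hτQ
  have hkey : τ₀ * τQ ^ (z * ν) = t ^ (1 + z * ν) := (freezeOutTime_rpow hτ₀ hτQ hzν).symm
  unfold relaxTime reducedParam
  rw [abs_of_pos (div_pos htpos hτQ), div_rpow htpos.le hτQ.le, div_div_eq_mul_div, hkey,
    rpow_add htpos, rpow_one, mul_div_assoc, div_self (rpow_pos_of_pos htpos _).ne', mul_one]

/-- **`ε̂ = ε(t̂) = (τ_0/τ_Q)^{1/(1+zν)}`**. [cite: DelCampoZurek2014KZM, §2 (display defining ε̂)] -/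
theorem reducedParam_freezeOutTime (hτ₀ : 0 < τ₀) (hτQ : 0 < τQ) (hzν : 0 ≤ z * ν) :
    reducedParam τQ (freezeOutTime τ₀ τQ z ν) = freezeOutEps τ₀ τQ z ν := by
  unfold reducedParam freezeOutTime freezeOutEps
  have hp : (1 + z * ν) ≠ 0 := by positivity
  have hτQ' : (τQ ^ (1 + z * ν)) ^ (1 / (1 + z * ν)) = τQ := by
    rw [← rpow_mul hτQ.le, one_div, mul_inv_cancel₀ hp, rpow_one]
  rw [show (τ₀ * τQ ^ (z * ν)) ^ (1 / (1 + z * ν)) / τQ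
      = (τ₀ * τQ ^ (z * ν)) ^ (1 / (1 + z * ν)) / (τQ ^ (1 + z * ν)) ^ (1 / (1 + z * ν)) by
    rw [hτQ']]
  rw [← div_rpow (mul_pos hτ₀ (rpow_pos_of_pos hτQ _)).le (rpow_pos_of_pos hτQ _).le]
  congr 1
  rw [rpow_add hτQ, rpow_one]
  field_simp

/-- `ε̂ > 0`. [folklore] -/
private theorem freezeOutEps_pos (hτ₀ : 0 < τ₀) (hτQ : 0 < τQ) : 0 < freezeOutEps τ₀ τQ z ν :=
  rpow_pos_of_pos (div_pos hτ₀ hτQ) _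

/-- **`ξ̂ = ξ[ε̂] = ξ_0 (τ_Q/τ_0)^{ν/(1+zν)}`** — the correlation length evaluated at `ε̂`.
[cite: DelCampoZurek2014KZM, §2 ("The KZM sets the average size of these domains by the value of
the equilibrium correlation length at ε̂")] -/
theorem corrLength_freezeOutEps (ξ₀ : ℝ) (hτ₀ : 0 < τ₀) (hτQ : 0 < τQ) :
    corrLength ξ₀ ν (freezeOutEps τ₀ τQ z ν) = freezeOutLength ξ₀ τ₀ τQ z ν := by
  unfold corrLength freezeOutLength freezeOutEps
  rw [abs_of_pos (rpow_pos_of_pos (div_pos hτ₀ hτQ) _), ← rpow_mul (div_pos hτ₀ hτQ).le,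
    one_div, inv_mul_eq_div, div_eq_mul_inv ξ₀, ← inv_rpow (div_pos hτ₀ hτQ).le, inv_div]

/-- Worked instance of the two displays (non-vacuity): `τ_0 = 1`, `τ_Q = 4`, `z = ν = 1` give
`t̂ = (1·4)^{1/2} = 2`. [cite: DelCampoZurek2014KZM, §2 (display for t̂)] -/
theorem freezeOutTime_example : freezeOutTime 1 4 1 1 = 2 := by
  unfold freezeOutTime
  rw [show (1:ℝ) / (1 + 1 * 1) = 1 / 2 by norm_num,
    show (1:ℝ) * (4:ℝ) ^ ((1:ℝ) * 1) = 2 ^ (2:ℝ) by norm_num, ← rpow_mul (by norm_num : (0:ℝ) ≤ 2)]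
  norm_num

/-- … and `ε̂ = (1/4)^{1/2} = 1/2 = t̂/τ_Q`. [cite: DelCampoZurek2014KZM, §2 (display defining ε̂)] -/
theorem freezeOutEps_example : freezeOutEps 1 4 1 1 = 1 / 2 := by
  unfold freezeOutEps
  rw [show (1:ℝ) / (1 + 1 * 1) = 1 / 2 by norm_num, show (1:ℝ) / 4 = (1 / 2) ^ (2:ℝ) by norm_num,
    ← rpow_mul (by norm_num : (0:ℝ) ≤ 1 / 2)]
  norm_num

end

/-! ## §3 Defect density and the Kibble–Zurek exponent -/

section

variable {ξ₀ τ₀ τQ z ν : ℝ}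

/-- **`n ∼ ξ̂^d/ξ̂^D = ξ_0^{−(D−d)} (τ_0/τ_Q)^{(D−d)ν/(1+zν)}`** for defects of dimension `d` in
`D` space dimensions (`d ≤ D`). [cite: DelCampoZurek2014KZM, §2 (display for n)] -/
theorem defect_density_eq (hξ₀ : 0 < ξ₀) (hτ₀ : 0 < τ₀) (hτQ : 0 < τQ) {D d : ℕ} (hdD : d ≤ D) :
    freezeOutLength ξ₀ τ₀ τQ z ν ^ d / freezeOutLength ξ₀ τ₀ τQ z ν ^ D
      = defectEstimate ξ₀ τ₀ τQ z ν D d := by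
  unfold freezeOutLength defectEstimate kzExponent
  have hr : 0 < τQ / τ₀ := div_pos hτQ hτ₀
  have hb : 0 < (τQ / τ₀) ^ (ν / (1 + z * ν)) := rpow_pos_of_pos hr _
  have hL : 0 < ξ₀ * (τQ / τ₀) ^ (ν / (1 + z * ν)) := mul_pos hξ₀ hb
  obtain ⟨k, rfl⟩ := Nat.exists_eq_add_of_le hdD
  rw [Nat.add_sub_cancel_left, pow_add, div_mul_eq_div_div, div_self (pow_pos hL d).ne', one_div,
    mul_pow, mul_inv]
  congr 1
  rw [← rpow_natCast, ← rpow_mul hr.le, ← inv_rpow hr.le, inv_div]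
  congr 1
  push_cast
  ring

/-- The exponent of the transverse-field Ising chain (kinks, `d = 0`, in `D = 1`; `ν = z = 1`):
`(1 − 0)·1/(1 + 1·1) = 1/2` — "the resulting amount of excitations is found to scale as
`n ∝ τ_Q^{−1/2}`". [cite: DelCampoZurek2014KZM, §3.2] -/
theorem kzExponent_ising_chain : kzExponent 1 0 1 1 = 1 / 2 := by
  norm_num [kzExponent]

/-- The same exponent read as a density: for `ν = z = 1`, `D = 1`, `d = 0` the estimate is
`n = ξ_0⁻¹ (τ_0/τ_Q)^{1/2}`. [cite: DelCampoZurek2014KZM, §3.2 ("n ∝ τ_Q^{−1/2}")] -/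
theorem defectEstimate_ising_chain (ξ₀ τ₀ τQ : ℝ) :
    defectEstimate ξ₀ τ₀ τQ 1 1 1 0 = ξ₀⁻¹ * (τ₀ / τQ) ^ (1 / 2 : ℝ) := by
  simp [defectEstimate, kzExponent_ising_chain]

/-- Consequence proved here (not a printed display): for a nonnegative Kibble–Zurek exponent the
defect estimate is ANTITONE in the quench time — a slower quench (larger `τ_Q`) leaves fewer
defects. [cite: DelCampoZurek2014KZM, §2 (display for n)] -/
theorem defectEstimate_antitone (hξ₀ : 0 < ξ₀) (hτ₀ : 0 < τ₀) {D d : ℕ} (hexp : 0 ≤ kzExponent D d ν z)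
    {τQ τQ' : ℝ} (hτQ : 0 < τQ) (hle : τQ ≤ τQ') :
    defectEstimate ξ₀ τ₀ τQ' z ν D d ≤ defectEstimate ξ₀ τ₀ τQ z ν D d := by
  unfold defectEstimate
  have hξ : 0 ≤ (ξ₀ ^ (D - d))⁻¹ := inv_nonneg.mpr (pow_nonneg hξ₀.le _)
  refine mul_le_mul_of_nonneg_left ?_ hξ
  have hτQ' : 0 < τQ' := lt_of_lt_of_le hτQ hle
  exact rpow_le_rpow (div_pos hτ₀ hτQ').le (div_le_div_of_nonneg_left hτ₀.le hτQ hle) hexp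

end

end KibbleZurek

end Literature.MathematicalPhysics.StatisticalMechanics
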